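import Summits.Langlands.Langlands.Theses.PhantomRMYoshida
import Literature.NumberTheory.Automorphic.SerreConjectureProofs
import Literature.NumberTheory.GaloisRepresentations.SerreWeightLowerBoundProofs
import Literature.NumberTheory.Automorphic.NewformAdelisationHeckeOperator
import Literature.NumberTheory.Automorphic.CuspidalRepDataOfCuspForm
import Literature.NumberTheory.Automorphic.NewformAdelisationArchCovariance

/-!
# drefute g2 probe: the glue of line `adelic-newform-datum-double-twist` runs on the WEAK form
# of Serre's conjecture once `2 ≤ w` is dropped from stubs 5 and 7

Refuter scratch (refuter-drefute-stmt-Langlands-12944-g2-0).  Hypotheses `h2 h3 h4 h6` are the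
lead's registered stubs 2, 3, 4, 6 VERBATIM; `h5'`, `h7'` are stubs 5, 7 with the hypothesis
`2 ≤ w` / `2 ≤ k` DELETED (both hold for every weight: drefute r1 §Stub 5/§Stub 7, g2 notes);
`hS` is the tree's WEAK named fact `exists_newform_of_odd_irreducible` (lang.S37 weak form,
SerreConjecture.lean:147) for all `p, k` — implied by `khare_wintenberger` through the proved
`exists_newform_of_odd_irreducible_of_khare_wintenberger` (SerreConjectureProofs:240), and NOT
mentioning `serreLevel` / `serreWeight` / `LocalRestrictionAt` (the Serre-recipe typing).
Conclusion: the crux.  So the terminal `proof.conditional` theorem can be conditioned on the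
weak form (smaller meaning-trust base) at the price of proving stubs 5, 7 without `2 ≤ w`.
-/

noncomputable section

open scoped MatrixGroups Classical Polynomial
open NumberField IsDedekindDomain Filter Polynomial CongruenceSubgroup
open Literature.NumberTheory.Automorphic Literature.NumberTheory.EllipticCurves.ModularForms
  Literature.NumberTheory.GaloisRepresentations
  Literature.NumberTheory.GaloisRepresentations.ModPGaloisRep
  Literature.NumberTheory.GaloisRepresentations.IsNonarchimedeanLocalField

namespace Summit.Langlands.Langlands.Cruxes.SerreKWAutomorphicGL2.DrefuteG2

set_option linter.unusedVariables false
set_option linter.dupNamespace false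

/-- copy of the skeleton's glue lemma (proved there). -/
theorem arithFrobPolyOfSatake_one_rootsInv {p : ℕ} [Fact p.Prime] (ι : PadicAlgCl p ≃+* ℂ)
    (q : ℕ) {P : ℂ[X]} (hP : P.Monic) :
    arithFrobPolyOfSatake ι q 1 (P.roots.map (·⁻¹)) = P.map (ι.symm : ℂ →+* PadicAlgCl p) := by
  rw [arithFrobPolyOfSatake_one, Multiset.map_map]
  have hcard : Multiset.card P.roots = P.natDegree :=
    Polynomial.splits_iff_card_roots.mp (IsAlgClosed.splits P)
  trans (P.roots.map fun β ↦ (X - C β).map (ι.symm : ℂ →+* PadicAlgCl p)).prod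
  · congr 1
    refine Multiset.map_congr rfl fun β _ ↦ ?_
    simp only [Function.comp_apply, inv_inv, Polynomial.map_sub, Polynomial.map_X, Polynomial.map_C]
    rfl
  · conv_rhs => rw [← Polynomial.prod_multiset_X_sub_C_of_monic_of_roots_card_eq hP hcard]
    rw [Polynomial.map_multiset_prod, Multiset.map_map]
    rfl

theorem finite_setOf_primesEquiv_dvd {n : ℕ} (hn : n ≠ 0) :
    {v : HeightOneSpectrum (𝓞 ℚ) | ((Rat.HeightOneSpectrum.primesEquiv v : Nat.Primes) : ℕ) ∣ n}.Finite := by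
  refine ((Set.finite_Iic n).preimage
    (f := fun v : HeightOneSpectrum (𝓞 ℚ) ↦ ((Rat.HeightOneSpectrum.primesEquiv v : Nat.Primes) : ℕ))
    ?_).subset ?_
  · intro v _ v' _ hvv'
    exact Rat.HeightOneSpectrum.primesEquiv.injective (Subtype.ext hvv')
  · intro v hv
    exact Nat.le_of_dvd (Nat.pos_of_ne_zero hn) hv

theorem eventually_not_dvd {n : ℕ} (hn : n ≠ 0) :
    ∀ᶠ v : HeightOneSpectrum (𝓞 ℚ) in Filter.cofinite,
      ¬ ((Rat.HeightOneSpectrum.primesEquiv v : Nat.Primes) : ℕ) ∣ n := by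
  rw [Filter.eventually_cofinite]
  simpa only [not_not] using finite_setOf_primesEquiv_dvd hn

theorem adelicLiftFunA_ne_zero_of_isNewform1 {M : ℕ} [NeZero M] {w : ℤ} {g : CuspForm (Gamma1 M) w}
    (hg : IsNewform1 g) : adelicLiftFunA M w ⇑g ≠ 0 := by
  have hg0 : g ≠ 0 := by
    rintro rfl
    have h1 := hg.2.2.2
    unfold IsNormalized at h1
    rw [CuspForm.coe_zero, UpperHalfPlane.qExpansion_zero, map_zero] at h1
    exact zero_ne_one h1
  have hex : ∃ τ₀ : UpperHalfPlane, g τ₀ ≠ 0 := by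
    by_contra h
    exact hg0 (DFunLike.ext g 0 fun τ₀ => by rw [not_exists.mp h τ₀ |> not_not.mp]; rfl)
  obtain ⟨x, -, hx⟩ := exists_adelicLiftFun_ne_zero (N := M) (k := w) g hex
  intro h0
  apply hx
  have h1 : adelicLiftFunA M w ⇑g (Rat.ofRealGL 2 x) = 0 := by rw [h0]; rfl
  simpa using h1

/-- **The crux from the WEAK form of Serre's conjecture + stubs 2, 3, 4, 6 verbatim + stubs 5, 7
without `2 ≤ w`.** -/
theorem SerreKWAutomorphicGL2_of_weakSerre
    (hS : ∀ (p : ℕ) [Fact p.Prime] (k : Type) [Field k] [TopologicalSpace k] [DiscreteTopology k],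
      exists_newform_of_odd_irreducible (p := p) (k := k))
    (h2 : ∀ (p : ℕ) [Fact p.Prime] (k : Type) [Field k] [CharP k p] [IsAlgClosed k]
      (red : Valued.integer (PadicAlgCl p) →+* k) (ι : PadicAlgCl p ≃+* ℂ)
      (N : ℕ) [NeZero N] (w : ℤ) (f : CuspForm (Gamma1 N) w), IsNewform1 f →
      ∀ (j : coeffCharIntegers f →+* k),
        ∃ (τ : coeffCharField f →+* ℂ) (θ : coeffCharIntegers f →+* Valued.integer (PadicAlgCl p)),
          (∀ x : coeffCharIntegers f,
              ((θ x : Valued.integer (PadicAlgCl p)) : PadicAlgCl p) =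
                ι.symm (τ (algebraMap (coeffCharIntegers f) (coeffCharField f) x))) ∧
          ∀ x : coeffCharIntegers f, red (θ x) = j x)
    (h3 : ∀ (N : ℕ) [NeZero N] (w : ℤ) (f : CuspForm (Gamma1 N) w), IsNewform1 f →
      ∀ τ : coeffCharField f →+* ℂ,
        ∃ (M : ℕ) (_ : NeZero M) (g : CuspForm (Gamma1 M) w), IsNewform1 g ∧
          ∀ q : ℕ, q.Prime → ¬ q ∣ N * M →
            (heckePolynomial g q).map (algebraMap (coeffCharField g) ℂ) =
              (heckePolynomial f q).map τ)
    (h4 : ∀ (N : ℕ) [NeZero N] (w : ℤ) (f : CuspForm (Gamma1 N) w)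
      (hcpt : isCompact_glFiniteIntegralLevel 2 ℚ),
      IsArchSmooth (AutomorphyDatum.gl 2 ℚ hcpt).ofArch (adelicLiftFunA N w ⇑f) ∧
        GL2Real.lowerFun Rat.iotaA (adelicLiftFunA N w ⇑f) = 0)
    (h5' : ∀ (N : ℕ) [NeZero N] (w : ℤ) (f : CuspForm (Gamma1 N) w)
      (hcpt : isCompact_glFiniteIntegralLevel 2 ℚ),
      IsArchSmooth (AutomorphyDatum.gl 2 ℚ hcpt).ofArch (adelicLiftFunA N w ⇑f) →
      GL2Real.lowerFun Rat.iotaA (adelicLiftFunA N w ⇑f) = 0 →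
      IsCuspFormGL 2 ℚ hcpt (adelicLiftFunA N w ⇑f))
    (h6 : ∀ (N : ℕ) [NeZero N] (w : ℤ) (f : CuspForm (Gamma1 N) w)
      (hcpt : isCompact_glFiniteIntegralLevel 2 ℚ),
      GL2Real.lowerFun Rat.iotaA (adelicLiftFunA N w ⇑f) = 0 →
      ∀ (hφ : adelicLiftFunA N w ⇑f ∈ cuspFormsGL 2 ℚ hcpt) (hφ0 : adelicLiftFunA N w ⇑f ≠ 0),
      (CuspidalAutomorphicRepData.ofCuspForm hφ hφ0).1.HasArchParameter
        (fun _ => ({((w : ℂ) - 1) / 2, (1 - (w : ℂ)) / 2} : Multiset ℂ)))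
    (h7' : ∀ (N : ℕ) [NeZero N] (k : ℤ) (f : CuspForm (Gamma1 N) k), IsNewform1 f →
      ∀ (hcpt : isCompact_glFiniteIntegralLevel 2 ℚ) (π : CuspidalAutomorphicRepData 2 ℚ hcpt),
        adelicLiftFunA N k ⇑f ∈ π.1.W → adelicLiftFunA N k ⇑f ∉ π.1.W' →
        π.1.HasArchParameter (fun _ => ({((k : ℂ) - 1) / 2, (1 - (k : ℂ)) / 2} : Multiset ℂ)) →
          ∃ π₂ : CuspidalAutomorphicRepData 2 ℚ hcpt, π₂.1.IsLAlgebraic ∧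
            ∀ᶠ v : HeightOneSpectrum (𝓞 ℚ) in Filter.cofinite,
              π₂.1.HasSatakeParamAt v
                (((heckePolynomial f ((Rat.HeightOneSpectrum.primesEquiv v : Nat.Primes) : ℕ)).map
                    (algebraMap (coeffCharField f) ℂ)).roots.map (·⁻¹))) :
    Summit.Langlands.Langlands.Theses.PhantomRMYoshida.SerreKWAutomorphicGL2 := by
  intro p _ k _ _ _ _ _ red σ hodd hirr hcpt₂ ι
  -- (A) Galois side: WEAK Serre (no weight bound), alignment, conjugation
  obtain ⟨N, _instN, w, f, ιf, hf, hKW⟩ := hS p k σ hirr hodd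
  obtain ⟨τ, θ, hθ, hred⟩ := h2 p k red ι N (w : ℤ) f hf ιf
  obtain ⟨M, _instM, g, hg, hconj⟩ := h3 N (w : ℤ) f hf τ
  -- (B) automorphic side for the conjugate newform `g`, ANY weight
  obtain ⟨hsm, hlow⟩ := h4 M (w : ℤ) g hcpt₂
  have hφ : adelicLiftFunA M (w : ℤ) ⇑g ∈ cuspFormsGL 2 ℚ hcpt₂ :=
    (h5' M _ g hcpt₂ hsm hlow).mem_cuspFormsGL
  have hφ0 : adelicLiftFunA M (w : ℤ) ⇑g ≠ 0 := adelicLiftFunA_ne_zero_of_isNewform1 hg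
  have harch := h6 M _ g hcpt₂ hlow hφ hφ0
  obtain ⟨π₂, hL, hsat₂⟩ :=
    h7' M _ g hg hcpt₂ (CuspidalAutomorphicRepData.ofCuspForm hφ hφ0)
      (CuspidalAutomorphicRepData.mem_W_ofCuspForm hφ hφ0)
      (CuspidalAutomorphicRepData.not_mem_W'_ofCuspForm hφ hφ0) harch
  refine ⟨π₂, hL, ?_⟩
  have hp : p.Prime := Fact.out
  have hgoodNp := eventually_not_dvd (n := N * p) (mul_ne_zero (NeZero.ne N) hp.ne_zero)
  have hgoodNM := eventually_not_dvd (n := N * M) (mul_ne_zero (NeZero.ne N) (NeZero.ne M))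
  filter_upwards [hsat₂, hgoodNp, hgoodNM] with v hv hvNp hvNM
  obtain ⟨hunr, Pint, hPint, hFrob⟩ := hKW v hvNp
  refine ⟨_, Pint.map θ, Pint.map ιf, hv, ?_, hunr, hFrob, ?_⟩
  · have hmonic : ((heckePolynomial g ((Rat.HeightOneSpectrum.primesEquiv v : Nat.Primes) : ℕ)).map
        (algebraMap (coeffCharField g) ℂ)).Monic :=
      (monic_heckePolynomial g _).map _
    have hθ' : (Valued.integer (PadicAlgCl p)).subtype.comp θ =
        ((ι.symm : ℂ →+* PadicAlgCl p).comp τ).comp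
          (algebraMap (coeffCharIntegers f) (coeffCharField f)) :=
      RingHom.ext fun x => hθ x
    rw [arithFrobPolyOfSatake_one_rootsInv ι _ hmonic,
      hconj _ (Rat.HeightOneSpectrum.primesEquiv v).2 hvNM]
    simp only [Polynomial.map_map]
    rw [← hPint, Polynomial.map_map, hθ']
  · rw [Polynomial.map_map]
    exact congrArg (fun F : coeffCharIntegers f →+* k => Pint.map F) (RingHom.ext hred)

/-- And the weak form for all `p, k` follows from the named fact `khare_wintenberger` for all
`p, k` (tree: `exists_newform_of_odd_irreducible_of_khare_wintenberger`), so the weak-form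
conditional theorem is at least as strong as the planned KW-conditional one. -/
theorem weakSerre_of_khareWintenberger
    (hKW : ∀ (p : ℕ) [Fact p.Prime] (k : Type) [Field k] [TopologicalSpace k] [DiscreteTopology k],
      khare_wintenberger p k) :
    ∀ (p : ℕ) [Fact p.Prime] (k : Type) [Field k] [TopologicalSpace k] [DiscreteTopology k],
      exists_newform_of_odd_irreducible (p := p) (k := k) :=
  fun p _ k _ _ _ => exists_newform_of_odd_irreducible_of_khare_wintenberger p k (hKW p k)

/-! ## Convention pins behind `khare_wintenberger` as typed (KW-I p.2–3 read) -/

/-- The diamond operators of the tree (`diamondOp`, hence `nebentypus`, hence `heckePolynomial`)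
use Mathlib's `Gamma0Map` = the LOWER-RIGHT entry `d` of `γ = (a b; c d)`, i.e.
Diamond–Shurman's convention `f[γ]_k = χ(d_γ) f` — the one in which
`charpoly ρ_f(arith Frob_q) = X² - a_q X + χ(q) q^{k-1}` (DS Thm 9.6.5). -/
example (N : ℕ) (γ : Gamma0 N) : Gamma0Map N γ = ((γ.1 : Matrix (Fin 2) (Fin 2) ℤ) 1 1 : ZMod N) := rfl

/-- `HasFrobCharpolyAt` is about ARITHMETIC Frobenii (Mathlib `IsArithFrobAt`), matching the
arithmetic-Frobenius Hecke polynomial `heckePolynomial` (Deligne–Serre (6.1.1)). -/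
example {p : ℕ} {k : Type} [Field k] [TopologicalSpace k] (σ : FramedGaloisRep ℚ k 2)
    (v : HeightOneSpectrum (𝓞 ℚ)) (P : Polynomial k) :
    σ.HasFrobCharpolyAt v P ↔
      ∀ 𝔓 ∈ v.primesAbove, ∀ g : Field.absoluteGaloisGroup ℚ, IsArithFrobAt (𝓞 ℚ) g 𝔓 →
        FramedRep.charpoly σ g = P := Iff.rfl

/-- The Hecke polynomial read in `ℂ[X]` is literally `X² - a_q X + ε(q) q^{k-1}` with `a_q` the
`q`-expansion coefficient (not a Hecke eigenvalue) and `ε = nebentypus f`. -/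
example {N : ℕ} [NeZero N] {k : ℤ} (f : CuspForm (Gamma1 N) k) (q : ℕ) :
    (heckePolynomial f q).map (algebraMap (coeffCharField f) ℂ) =
      X ^ 2 - C ((UpperHalfPlane.qExpansion 1 ⇑f).coeff q) * X +
        C ((nebentypus f (q : ZMod N) : ℂ) * (q : ℂ) ^ (k - 1)) :=
  map_heckePolynomial f q

end Summit.Langlands.Langlands.Cruxes.SerreKWAutomorphicGL2.DrefuteG2

end
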